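import Mathlib.Probability.Moments.Variance
import Mathlib.Probability.Moments.Covariance
import Mathlib.Data.Nat.Dist
import Literature.Probability.Moments.CovarianceFreezing
import HarnessLib

/-!
# The halves test `V4` treats the two half means as independent: what that costs, and when it is conservative

HONEST FRAMING: exact (Metropolis-corrected) sampling algorithms for lattice gauge theory;
figures of merit are autocorrelation/cost numbers at stated couplings and volumes; no
continuum-physics claim.

Venture `LatticeQCDFlow` (cell pub-lqcd), sub-topic `Scoring`; FANOUT row 11 (`eng-scorerA`,
fitness scorer A).  NEW WORK of the cell (elementary second-moment algebra on a probability space,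
one use of the Literature lemma `covariance_sq_le_variance_mul`); not a published result, nothing is
cited as a tree fact.

## What the frozen scorer does

Scorer A 0.1.2's validity test `V4` (score.py `V4` block, basis string
`"unweighted per-stream halves, Gamma error"`) splits every scored stream into its first and second
half, estimates the two half means `A`, `B` with Γ-method errors `err_A`, `err_B` computed INSIDE each
half, and prints `z = |A − B| / √(err_A² + err_B²)`; `z > 3.5` is the HARD token
`V4:halves-inconsistent`, smaller values are informational.  The denominator is the standard
deviation of `A − B` for INDEPENDENT halves.  The halves of one Markov chain are not independent:
in the population version (errors = true standard deviations of the half means) the correctly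
normalised statistic has denominator `√Var(A − B) = √(Var A + Var B − 2 Cov(A, B))`.

## Content (population statements; `μ` a probability measure, all variables square integrable)

* `two_mul_abs_covariance_le` — `2 |Cov(X, Y)| ≤ Var X + Var Y` (Cauchy–Schwarz + AM–GM); hence
  `variance_sub_le_two_mul` / `variance_add_le_two_mul` — `Var(X ∓ Y) ≤ 2 (Var X + Var Y)`, and
  `variance_sum_le_card_mul` / `variance_avg_le` — `Var(∑_{i∈s} Xᵢ) ≤ |s| ∑ Var Xᵢ`,
  `Var((1/k) ∑_{i<k} Xᵢ) ≤ (1/k) ∑ Var Xᵢ` (the variance of an average is at most the average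
  variance — reused by `Scoring/Thinning`);
* `covariance_halfMeans` — `Cov(A, B) = (1/M²) ∑_{i<M} ∑_{j<M} Cov(Xᵢ, X_{M+j})`: the cross term is
  the average cross-half covariance;
* `variance_halfDiff_le_two_mul` — ALWAYS `Var(A − B) ≤ 2 (Var A + Var B)`: the printed `z²` is at
  most twice the correctly normalised one (`zSq_le_two_mul`), so a HARD flag at printed `z > 7/2` is a
  `> 7/(2√2) ≈ 2.47`-sigma event whatever the autocorrelations (`halves_flag_true_zSq_gt`:
  true `z² > 49/8 > (247/100)²`); the factor `2` is attained (`variance_sub_neg_self`: `B = −A`);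
* `covariance_halfMeans_nonneg`, `variance_halfDiff_le_add` — if every cross-half covariance
  `Cov(Xᵢ, X_{M+j})` is `≥ 0` then `Cov(A, B) ≥ 0` and `Var(A − B) ≤ Var A + Var B`: the printed
  denominator OVER-covers and the printed `z` UNDER-states the true one (`zSq_printed_le_true`) —
  the test is CONSERVATIVE (it can miss an inconsistency, it cannot manufacture one).  Nonnegative
  autocovariances at every lag are exactly what `Scoring/IMHPositiveCorrelations` proves for the exact
  independence-Metropolis (flow-MCMC) chain on a finite state space (`imh_twoTime_lawAt_nonneg`,
  `imh_sector_autocov_nonneg`), i.e. for the samplers this venture scores; for HMC / heat-bath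
  comparators negative autocovariances are possible and only the factor-`2` statement applies;
* `variance_halfDiff_eq_add` — independent (zero cross-covariance) halves: the printed normalisation
  is exact.

What is NOT here: the sampling distribution of the Γ-method error estimates themselves (finite-`N`
noise of `err_A`, `err_B`), which is a numerical-calibration matter (CALIBRATION-A of record), and any
statement about the `3.5` threshold's false-positive rate (policy).
-/

namespace Summit.Ventures.LatticeQCDFlow.Scoring

open Finset MeasureTheory ProbabilityTheory
open scoped BigOperators

variable {Ω : Type*} {mΩ : MeasurableSpace Ω} {μ : Measure Ω} [IsProbabilityMeasure μ]

/-! ### Cauchy–Schwarz consequences: the variance of a sum, a difference, an average -/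

/-- **`2 |Cov(X, Y)| ≤ Var X + Var Y`** for square-integrable `X`, `Y`: Cauchy–Schwarz
`Cov² ≤ Var X · Var Y` (Literature `covariance_sq_le_variance_mul`) followed by AM–GM
`4 Var X · Var Y ≤ (Var X + Var Y)²`. -/
theorem two_mul_abs_covariance_le {X Y : Ω → ℝ} (hX : MemLp X 2 μ) (hY : MemLp Y 2 μ) :
    2 * |cov[X, Y; μ]| ≤ Var[X; μ] + Var[Y; μ] := by
  have hcs := Literature.Probability.Moments.covariance_sq_le_variance_mul hX hY
  have hVX := variance_nonneg X μ
  have hVY := variance_nonneg Y μ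
  have h4 : (2 * cov[X, Y; μ]) ^ 2 ≤ (Var[X; μ] + Var[Y; μ]) ^ 2 := by
    nlinarith [hcs, sq_nonneg (Var[X; μ] - Var[Y; μ])]
  have habs : |2 * cov[X, Y; μ]| ≤ Var[X; μ] + Var[Y; μ] :=
    abs_le_of_sq_le_sq h4 (by positivity)
  rwa [abs_mul, abs_two] at habs

/-- `Var(X + Y) ≤ 2 (Var X + Var Y)`. -/
theorem variance_add_le_two_mul {X Y : Ω → ℝ} (hX : MemLp X 2 μ) (hY : MemLp Y 2 μ) :
    Var[X + Y; μ] ≤ 2 * (Var[X; μ] + Var[Y; μ]) := by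
  rw [variance_add hX hY]
  have h := two_mul_abs_covariance_le hX hY
  have := le_abs_self (cov[X, Y; μ])
  linarith

/-- `Var(X − Y) ≤ 2 (Var X + Var Y)` — whatever the sign of the covariance. -/
theorem variance_sub_le_two_mul {X Y : Ω → ℝ} (hX : MemLp X 2 μ) (hY : MemLp Y 2 μ) :
    Var[X - Y; μ] ≤ 2 * (Var[X; μ] + Var[Y; μ]) := by
  rw [variance_sub hX hY]
  have h := two_mul_abs_covariance_le hX hY
  have := neg_abs_le (cov[X, Y; μ])
  linarith

/-- Nonnegatively correlated `X`, `Y`: `Var(X − Y) ≤ Var X + Var Y` (the independent-case value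
over-covers). -/
theorem variance_sub_le_add_of_covariance_nonneg {X Y : Ω → ℝ} (hX : MemLp X 2 μ)
    (hY : MemLp Y 2 μ) (hc : 0 ≤ cov[X, Y; μ]) :
    Var[X - Y; μ] ≤ Var[X; μ] + Var[Y; μ] := by
  rw [variance_sub hX hY]
  linarith

/-- Uncorrelated `X`, `Y`: `Var(X − Y) = Var X + Var Y` exactly. -/
theorem variance_sub_eq_add_of_covariance_eq_zero {X Y : Ω → ℝ} (hX : MemLp X 2 μ)
    (hY : MemLp Y 2 μ) (hc : cov[X, Y; μ] = 0) :
    Var[X - Y; μ] = Var[X; μ] + Var[Y; μ] := by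
  rw [variance_sub hX hY, hc]
  ring

omit [IsProbabilityMeasure μ] in
/-- The factor `2` in `variance_sub_le_two_mul` is attained: `Y = −X` gives
`Var(X − Y) = Var(2X) = 4 Var X = 2 (Var X + Var Y)`. -/
theorem variance_sub_neg_self (X : Ω → ℝ) :
    Var[X - (-X); μ] = 2 * (Var[X; μ] + Var[-X; μ]) := by
  have h : X - (-X) = fun ω => 2 * X ω := by
    funext ω
    simp only [Pi.sub_apply, Pi.neg_apply]
    ring
  rw [h, variance_const_mul, variance_neg]
  ring

/-- **The variance of a sum is at most `|s|` times the sum of the variances**: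
`Var(∑_{i∈s} Xᵢ) = ∑_{i,j∈s} Cov(Xᵢ, Xⱼ) ≤ ∑_{i,j∈s} (Var Xᵢ + Var Xⱼ)/2 = |s| ∑_{i∈s} Var Xᵢ`. -/
theorem variance_sum_le_card_mul {ι : Type*} (s : Finset ι) (X : ι → Ω → ℝ)
    (hX : ∀ i ∈ s, MemLp (X i) 2 μ) :
    Var[∑ i ∈ s, X i; μ] ≤ (s.card : ℝ) * ∑ i ∈ s, Var[X i; μ] := by
  rw [variance_sum' hX]
  have hij : ∀ i ∈ s, ∀ j ∈ s,
      cov[X i, X j; μ] ≤ Var[X i; μ] / 2 + Var[X j; μ] / 2 := by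
    intro i hi j hj
    have h := two_mul_abs_covariance_le (hX i hi) (hX j hj)
    have := le_abs_self (cov[X i, X j; μ])
    linarith
  calc ∑ i ∈ s, ∑ j ∈ s, cov[X i, X j; μ]
      ≤ ∑ i ∈ s, ∑ j ∈ s, (Var[X i; μ] / 2 + Var[X j; μ] / 2) :=
        Finset.sum_le_sum fun i hi => Finset.sum_le_sum fun j hj => hij i hi j hj
    _ = ∑ i ∈ s, ((s.card : ℝ) * (Var[X i; μ] / 2) + (∑ j ∈ s, Var[X j; μ]) / 2) := by
        refine Finset.sum_congr rfl fun i _ => ?_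
        rw [Finset.sum_add_distrib, Finset.sum_const, nsmul_eq_mul, Finset.sum_div]
    _ = (s.card : ℝ) * ((∑ i ∈ s, Var[X i; μ]) / 2)
          + (s.card : ℝ) * ((∑ j ∈ s, Var[X j; μ]) / 2) := by
        rw [Finset.sum_add_distrib, Finset.sum_const, nsmul_eq_mul, ← Finset.mul_sum,
          Finset.sum_div]
    _ = (s.card : ℝ) * ∑ i ∈ s, Var[X i; μ] := by ring

omit [IsProbabilityMeasure μ] in
/-- Square integrability is preserved by division by a constant (bookkeeping for means). -/
theorem memLp_div_const {f : Ω → ℝ} {p : ENNReal} (hf : MemLp f p μ) (c : ℝ) :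
    MemLp (fun ω => f ω / c) p μ := by
  simpa only [div_eq_mul_inv] using hf.mul_const c⁻¹

/-- **The variance of an average is at most the average of the variances**:
`Var((1/k) ∑_{i<k} Xᵢ) ≤ (1/k) ∑_{i<k} Var Xᵢ` (`k ≥ 1`).  Equality needs all `Xᵢ` equal a.s. up
to constants; for independent `Xᵢ` the left side is `(1/k²) ∑ Var Xᵢ`, smaller by a factor `k`. -/
theorem variance_avg_le {k : ℕ} (hk : k ≠ 0) (X : ℕ → Ω → ℝ)
    (hX : ∀ i < k, MemLp (X i) 2 μ) :
    Var[fun ω => (∑ i ∈ range k, X i ω) / k; μ] ≤ (∑ i ∈ range k, Var[X i; μ]) / k := by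
  have hk' : (0 : ℝ) < k := by exact_mod_cast Nat.pos_of_ne_zero hk
  have hX' : ∀ i ∈ range k, MemLp (X i) 2 μ := fun i hi => hX i (mem_range.mp hi)
  have h1 : (fun ω => (∑ i ∈ range k, X i ω) / k)
      = fun ω => (∑ i ∈ range k, X i) ω * (k : ℝ)⁻¹ := by
    funext ω
    rw [Finset.sum_apply, div_eq_mul_inv]
  have hs := variance_sum_le_card_mul (range k) X hX'
  rw [Finset.card_range] at hs
  rw [h1, variance_mul_const]
  calc Var[∑ i ∈ range k, X i; μ] * ((k : ℝ)⁻¹) ^ 2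
      ≤ ((k : ℝ) * ∑ i ∈ range k, Var[X i; μ]) * ((k : ℝ)⁻¹) ^ 2 :=
        mul_le_mul_of_nonneg_right hs (sq_nonneg _)
    _ = (∑ i ∈ range k, Var[X i; μ]) / k := by
        field_simp

/-! ### The two half means of a window of `2M` samples -/

/-- The mean of the FIRST half `X₀, …, X_{M−1}` of a window of `2M` samples (score.py V4:
`half1`). -/
noncomputable def firstHalfMean (X : ℕ → Ω → ℝ) (M : ℕ) : Ω → ℝ :=
  fun ω => (∑ i ∈ range M, X i ω) / M

/-- The mean of the SECOND half `X_M, …, X_{2M−1}` (score.py V4: `half2`). -/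
noncomputable def secondHalfMean (X : ℕ → Ω → ℝ) (M : ℕ) : Ω → ℝ :=
  fun ω => (∑ j ∈ range M, X (M + j) ω) / M

section Halves

variable {X : ℕ → Ω → ℝ} {M : ℕ}

omit [IsProbabilityMeasure μ] in
/-- The first-half mean is square integrable when the samples are. -/
theorem memLp_firstHalfMean (hX : ∀ n < 2 * M, MemLp (X n) 2 μ) :
    MemLp (firstHalfMean X M) 2 μ :=
  memLp_div_const (memLp_finsetSum (range M) fun i hi =>
    hX i (by have := mem_range.mp hi; omega)) _

omit [IsProbabilityMeasure μ] in
/-- The second-half mean is square integrable when the samples are. -/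
theorem memLp_secondHalfMean (hX : ∀ n < 2 * M, MemLp (X n) 2 μ) :
    MemLp (secondHalfMean X M) 2 μ :=
  memLp_div_const (memLp_finsetSum (range M) fun j hj =>
    hX (M + j) (by have := mem_range.mp hj; omega)) _

/-- **The cross term.**  `Cov(A, B) = (1/M²) ∑_{i<M} ∑_{j<M} Cov(Xᵢ, X_{M+j})`: the covariance of
the two half means is the average cross-half covariance (bilinearity). -/
theorem covariance_halfMeans (hX : ∀ n < 2 * M, MemLp (X n) 2 μ) :
    cov[firstHalfMean X M, secondHalfMean X M; μ]
      = (∑ i ∈ range M, ∑ j ∈ range M, cov[X i, X (M + j); μ]) / (M : ℝ) ^ 2 := by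
  unfold firstHalfMean secondHalfMean
  rw [covariance_fun_div_left, covariance_fun_div_right,
    covariance_fun_sum_fun_sum' (fun i hi => hX i (by have := mem_range.mp hi; omega))
      (fun j hj => hX (M + j) (by have := mem_range.mp hj; omega))]
  rw [div_div, sq]

/-- Nonnegative cross-half covariances (`Cov(Xᵢ, X_{M+j}) ≥ 0` for all `i, j < M`; e.g. a chain
with nonnegative autocovariances at every lag — exact IMH, `Scoring/IMHPositiveCorrelations`) make
the two half means nonnegatively correlated. -/
theorem covariance_halfMeans_nonneg (hX : ∀ n < 2 * M, MemLp (X n) 2 μ)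
    (hpos : ∀ i < M, ∀ j < M, 0 ≤ cov[X i, X (M + j); μ]) :
    0 ≤ cov[firstHalfMean X M, secondHalfMean X M; μ] := by
  rw [covariance_halfMeans hX]
  refine div_nonneg (Finset.sum_nonneg fun i hi => Finset.sum_nonneg fun j hj =>
    hpos i (mem_range.mp hi) j (mem_range.mp hj)) (sq_nonneg _)

/-- The same from a nonnegative lag-only autocovariance: if `Cov(X_a, X_b) = C |a − b|` on the
window and `C ≥ 0`, then `Cov(A, B) ≥ 0`. -/
theorem covariance_halfMeans_nonneg_of_cov_eq (hX : ∀ n < 2 * M, MemLp (X n) 2 μ) (C : ℕ → ℝ)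
    (hC : ∀ a < 2 * M, ∀ b < 2 * M, cov[X a, X b; μ] = C (Nat.dist a b)) (hCpos : ∀ t, 0 ≤ C t) :
    0 ≤ cov[firstHalfMean X M, secondHalfMean X M; μ] :=
  covariance_halfMeans_nonneg hX fun i hi j hj => by
    rw [hC i (by omega) (M + j) (by omega)]
    exact hCpos _

/-- **`V4` with the printed denominator is never anti-conservative by more than a factor `2` in
`z²`:** `Var(A − B) ≤ 2 (Var A + Var B)` for the two half means of any square-integrable window. -/
theorem variance_halfDiff_le_two_mul (hX : ∀ n < 2 * M, MemLp (X n) 2 μ) :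
    Var[firstHalfMean X M - secondHalfMean X M; μ]
      ≤ 2 * (Var[firstHalfMean X M; μ] + Var[secondHalfMean X M; μ]) :=
  variance_sub_le_two_mul (memLp_firstHalfMean hX) (memLp_secondHalfMean hX)

/-- **`V4` is conservative on nonnegatively cross-correlated halves:** `Var(A − B) ≤ Var A + Var B`,
i.e. the printed denominator `√(Var A + Var B)` is at least the true standard deviation of
`A − B`. -/
theorem variance_halfDiff_le_add (hX : ∀ n < 2 * M, MemLp (X n) 2 μ)
    (hpos : ∀ i < M, ∀ j < M, 0 ≤ cov[X i, X (M + j); μ]) :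
    Var[firstHalfMean X M - secondHalfMean X M; μ]
      ≤ Var[firstHalfMean X M; μ] + Var[secondHalfMean X M; μ] :=
  variance_sub_le_add_of_covariance_nonneg (memLp_firstHalfMean hX) (memLp_secondHalfMean hX)
    (covariance_halfMeans_nonneg hX hpos)

/-- Independent-in-the-second-moment halves (every cross-half covariance zero): the printed
normalisation IS the variance of `A − B`. -/
theorem variance_halfDiff_eq_add (hX : ∀ n < 2 * M, MemLp (X n) 2 μ)
    (hzero : ∀ i < M, ∀ j < M, cov[X i, X (M + j); μ] = 0) :
    Var[firstHalfMean X M - secondHalfMean X M; μ]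
      = Var[firstHalfMean X M; μ] + Var[secondHalfMean X M; μ] := by
  refine variance_sub_eq_add_of_covariance_eq_zero (memLp_firstHalfMean hX)
    (memLp_secondHalfMean hX) ?_
  rw [covariance_halfMeans hX]
  rw [Finset.sum_eq_zero fun i hi => Finset.sum_eq_zero fun j hj =>
    hzero i (mem_range.mp hi) j (mem_range.mp hj), zero_div]

end Halves

/-! ### What the normalisation does to the printed `z` -/

/-- The squared two-sample statistic with normalisation `v`: `z² = d² / v` (`d` = the observed
difference of the half means; `v` = the variance it is measured against — printed: `Var A + Var B`;
true: `Var(A − B)`). -/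
noncomputable def zSq (d v : ℝ) : ℝ :=
  d ^ 2 / v

/-- A larger normalisation gives a smaller `z²`: if the true variance `v` of the difference is at
most the printed `s` (conservative case, `variance_halfDiff_le_add`), the PRINTED `z²` is at most the
TRUE one — the test under-states significance, it cannot manufacture it. -/
theorem zSq_printed_le_true {d v s : ℝ} (hv : 0 < v) (hvs : v ≤ s) : zSq d s ≤ zSq d v := by
  unfold zSq
  exact div_le_div_of_nonneg_left (sq_nonneg d) hv hvs

/-- In general (`v ≤ 2 s`, `variance_halfDiff_le_two_mul`) the printed `z²` is at most TWICE the
true one. -/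
theorem zSq_le_two_mul {d v s : ℝ} (hv : 0 < v) (hvs : v ≤ 2 * s) :
    zSq d s ≤ 2 * zSq d v := by
  unfold zSq
  have hs : 0 < s := by linarith
  rw [div_le_iff₀ hs]
  calc d ^ 2 = 2 * (d ^ 2 / v) * (v / 2) := by field_simp
    _ ≤ 2 * (d ^ 2 / v) * s := by
        refine mul_le_mul_of_nonneg_left (by linarith) ?_
        exact mul_nonneg (by norm_num) (div_nonneg (sq_nonneg d) hv.le)

/-- **A HARD `V4` flag is a `≥ 2.47`-sigma event whatever the autocorrelations.**  If the printed
statistic exceeds the frozen threshold, `z_printed > 7/2`, then the correctly normalised one has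
`z_true² > 49/8` (`= (7/2)²/2 = 6.125 > 6.1009 = 2.47²`). -/
theorem halves_flag_true_zSq_gt {d v s : ℝ} (hv : 0 < v) (hvs : v ≤ 2 * s)
    (hflag : (7 / 2 : ℝ) ^ 2 < zSq d s) : 49 / 8 < zSq d v := by
  have h := zSq_le_two_mul (d := d) hv hvs
  have h49 : (7 / 2 : ℝ) ^ 2 = 49 / 4 := by norm_num
  linarith

/-- The numerical reading of `49/8`: it exceeds `(247/100)²`, i.e. `z_true > 2.47`. -/
theorem trueLevel_gt : ((247 : ℝ) / 100) ^ 2 < 49 / 8 := by norm_num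

/-- And on nonnegatively cross-correlated halves (`v ≤ s`) a HARD flag keeps its face value:
`z_true² > (7/2)²`. -/
theorem halves_flag_true_zSq_gt_of_conservative {d v s : ℝ} (hv : 0 < v) (hvs : v ≤ s)
    (hflag : (7 / 2 : ℝ) ^ 2 < zSq d s) : (7 / 2 : ℝ) ^ 2 < zSq d v :=
  hflag.trans_le (zSq_printed_le_true hv hvs)

end Summit.Ventures.LatticeQCDFlow.Scoring
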